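import Summits.QuantumFields.GaugeBoot.TiltedBoxRedSiteTubeValue
import Summits.QuantumFields.GaugeBoot.TiltedBoxRedSiteTrick
import Summits.QuantumFields.GaugeBoot.DiagonalRPTorusCharacterMoments
import Summits.QuantumFields.GaugeBoot.DiagonalRPTorusUnitaryCharacter
import Literature.MathematicalPhysics.QuantumLattice.GaugeGroups
import Literature.MathematicalPhysics.QuantumFieldTheory.LatticeGaugeTorusAreaLaw
import Literature.MathematicalPhysics.QuantumFieldTheory.LatticeGaugeAsymptoticsFreeEnergyProofs
import HarnessLib

/-!
# REDUCED-half site reflection positivity FAILS on the even square tilted box in `d ≥ 3`, at small coupling (gauge-boot, L3 supplement: reduced-half in-plane mirrors, 7/7)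

HONEST FRAMING (cell `pub-gaugeboot`, page 1 of every file): the venture produces certified bounds
on lattice expectations at stated coupling, gauge group, dimension and torus size; NOT a mass gap,
NOT a continuum limit, NOT a string tension; NOT Yang–Mills-summit-bearing (barriers
`FixedCouplingUltralocality`, `PerturbativeInvisibility`). This module is a small structural
NEGATIVE result about which positivity blocks a certificate on the tilted box may use; it
discharges nothing else.

## Content

`TiltedBoxEvenAxisRPTwoDim.lean` (gen 50) proves that in TWO dimensions the site mirror
`Θ_i : x_i ↦ -x_i` of the even square tilted box `ℤ^d/Γ(2P, 2P, L)` IS reflection positive for the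
REDUCED half `{0 ≤ x_i ≤ P - 1}` (`TwoDim.IsRedSiteLink`; twisted layer `x_i ≡ P` free), at every
real `β` — whereas the closed half `{0 ≤ x_i ≤ P}` fails at every `β` in every `d ≥ 2`
(`not_tiltedBox_axisRP`). Here: **in `d ≥ 3` the reduced half fails too, at small coupling.**

* ★★ **`trickSum_neg_of_small`** — for `P ≥ 2`, `L ≥ 2`, a transverse direction pair `q`
  (`q₁, q₂ ≠ i`: `d ≥ 3`), compact metrisable `G`, continuous `ρ` with a centre element
  `ρ z₀ = ω • 1` (`ω ≠ 1`) and the character identity (R1) with `c₁ > 0`: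
  `∃ β₀ > 0, ∀ 0 < β ≤ β₀, trickSum < 0` — the far pair terms vanish through order `8`
  (`pairT_far_eq_zero`), the near ones are the two tube terms `≥ β⁸ c₁⁹ N - O(β⁹)`
  (`pairT_tube_ge`) entering with a minus sign, the tail `|Q| ≥ 9` is `O(β⁹)`;
* ★★★ **`not_tiltedBox_axisRP_even_red_of_moments`** / **`_specialUnitary`** (`SU(N)`, `N ≥ 2`) /
  **`_unitary`** (`U(N)`, `N ≥ 1`): `∃ β₀ > 0, ∀ 0 < β ≤ β₀`, reduced-half site RP along `i` — the
  literal shape of `TwoDim.tiltedBox_axisRP_even_twoDim` without its two-dimensionality hypothesis —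
  FAILS; concrete **`not_tiltedBox_axisRP_even_red_suN`** / **`_uN`** on `ℤ³/Γ(2P, 2P, L)`
  (`i = 0`, `j = 1`, `q = (1, 2)`).

So the twisted free layer is NOT the only obstruction in `d ≥ 3`: a length-two tube through it
couples the reduced half to its mirror image at order `β⁸` with the wrong geometry (the mirror image
of a plaquette sits above its `T`-translate). `β₀` depends on the box; no uniformity in `P`, `L` is
claimed; `d = 2` is genuinely different (positive). Small new negative; mechanism folklore
(strong-coupling cluster expansion, M. Creutz 1983 Ch. 8–10; FILS 1980 §3; Biskup 2009 §5.5).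
-/

noncomputable section

open QuotientAddGroup Finset Function MeasureTheory
open scoped ComplexConjugate ComplexOrder
open Literature.MathematicalPhysics.QuantumFieldTheory (haarProbability IsSpecialUnitaryModel IsUnitaryModel)
open Literature.MathematicalPhysics.QuantumFieldTheory.PlaquetteLowerBound (reTr)
open Literature.RepresentationTheory.CompactGroups

namespace Summit.QuantumFields.GaugeBoot

namespace TiltedRP

namespace RedSite

variable {d : ℕ} {i j : Fin d} {L P N : ℕ} [NeZero L] [NeZero P]
variable {G : Type*} [Group G] [TopologicalSpace G] [IsTopologicalGroup G] [CompactSpace G]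
  [MeasurableSpace G] [BorelSpace G] [SecondCountableTopology G]
variable (ρ : G →* Matrix (Fin N) (Fin N) ℂ) (q : DirPair d)

/-! ## The tube lies in the rest -/

/-- The standing plaquette on a transverse link of the layer `P - 1` and the hanging plaquette under a
transverse link of the layer `P + 1` are rest plaquettes. [folklore] -/
theorem tube_subset_restSet [DecidableEq (TiltedSite d i j (2 * P) (2 * P) L)] (hP : 2 ≤ P)
    (hq1 : q.1.1 ≠ i) (hq2 : q.1.2 ≠ i) {z w : TiltedSite d i j (2 * P) (2 * P) L}
    (hz : (axisCoord d L (2 * P) z).val = P - 1) (hw : (axisCoord d L (2 * P) w).val = P + 1) :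
    tube q (w, q) (z, q) ⊆ restSet d i j L P := by
  intro p hp
  rw [mem_restSet]
  rcases (mem_tube q).1 hp with ⟨a, rfl⟩ | ⟨a, rfl⟩
  · obtain ⟨hl, hdir⟩ := hasLink_transverse q hq1 hq2 z
      (ℓ := PairExp.plink (tiltedUnit d i j (2 * P) (2 * P) L) ((z, q) : Plaq _ d) a) ⟨a, rfl⟩
    refine Or.inl ⟨stdDir_hasDir q hdir, Or.inl ?_⟩
    show (axisCoord d L (2 * P) (PairExp.plink (tiltedUnit d i j (2 * P) (2 * P) L) ((z, q) : Plaq _ d) a).1).val = P - 1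
    rw [hl, hz]
  · obtain ⟨hl, hdir⟩ := hasLink_transverse q hq1 hq2 w
      (ℓ := PairExp.plink (tiltedUnit d i j (2 * P) (2 * P) L) ((w, q) : Plaq _ d) a) ⟨a, rfl⟩
    refine Or.inl ⟨stdDir_hasDir q hdir, Or.inr ?_⟩
    show (axisCoord d L (2 * P) ((PairExp.plink (tiltedUnit d i j (2 * P) (2 * P) L) ((w, q) : Plaq _ d) a).1 -
      tiltedUnit d i j (2 * P) (2 * P) L i)).val = P
    have h := val_axisCoord_sub_self hP (PairExp.plink (tiltedUnit d i j (2 * P) (2 * P) L) ((w, q) : Plaq _ d) a).1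
      (by rw [hl, hw]; omega)
    rw [hl, hw] at h; omega

/-! ## The trick sum is negative at small coupling -/

omit [NeZero L] [NeZero P] in
/-- The sum of a pair-term family over the rest sets of size `≤ 8` vanishes when each term does.
[folklore] -/
theorem sum_filter_eq_zero_of {R : Finset (Plaq (TiltedSite d i j (2 * P) (2 * P) L) d)} {f : Finset (Plaq (TiltedSite d i j (2 * P) (2 * P) L) d) → ℝ}
    (h : ∀ Q, Q ⊆ R → Q.card ≤ 8 → f Q = 0) :
    ∑ Q ∈ R.powerset.filter (fun Q => Q.card ≤ 8), f Q = 0 :=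
  sum_eq_zero fun Q hQ => by
    rw [mem_filter, mem_powerset] at hQ
    exact h Q hQ.1 hQ.2

omit [NeZero L] [NeZero P] in
/-- The sum of a pair-term family over the rest sets of size `≤ 8` is its value at `Q₀` when every
other term vanishes and `Q₀ ⊆ R`, `|Q₀| ≤ 8`. [folklore] -/
theorem sum_filter_eq_single_of {R Q₀ : Finset (Plaq (TiltedSite d i j (2 * P) (2 * P) L) d)}
    {f : Finset (Plaq (TiltedSite d i j (2 * P) (2 * P) L) d) → ℝ} (hQ₀ : Q₀ ⊆ R) (hc : Q₀.card ≤ 8)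
    (h : ∀ Q, Q ⊆ R → Q.card ≤ 8 → Q ≠ Q₀ → f Q = 0) :
    ∑ Q ∈ R.powerset.filter (fun Q => Q.card ≤ 8), f Q = f Q₀ := by
  refine sum_eq_single_of_mem Q₀ (by rw [mem_filter, mem_powerset]; exact ⟨hQ₀, hc⟩) fun Q hQ hne => ?_
  rw [mem_filter, mem_powerset] at hQ
  exact h Q hQ.1 hQ.2 hne
set_option maxHeartbeats 400000 in
/-- ★★ **The trick sum is negative at small coupling** (`P ≥ 2`, `L ≥ 2`, `q₁, q₂ ≠ i`, centre element,
(R1) with `c₁ > 0`, `N ≥ 1`): `∃ β₀ > 0, ∀ 0 < β ≤ β₀, trickSum < 0`. [folklore] -/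
theorem trickSum_neg_of_small (hP : 2 ≤ P) (hij : i ≠ j) (hL : 2 ≤ L) (hq1 : q.1.1 ≠ i) (hq2 : q.1.2 ≠ i)
    (hρ : Continuous ρ) (hN : 1 ≤ N) {z₀ : G} {ω : ℂ} (hz₀ : ρ z₀ = ω • (1 : Matrix (Fin N) (Fin N) ℂ)) (hω : ω ≠ 1)
    {c₁ : ℝ} (hc₁ : 0 < c₁)
    (hR1 : ∀ x y : G, ∫ g, reTr ρ (x * g⁻¹) * reTr ρ (g * y) ∂haarProbability G = c₁ * reTr ρ (x * y)) :
    ∃ β₀ : ℝ, 0 < β₀ ∧ ∀ β : ℝ, 0 < β → β ≤ β₀ → trickSum d i j L P ρ q β < 0 := by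
  classical
  set e := tiltedUnit d i j (2 * P) (2 * P) L with he_def
  set T := tiltedTwist d L (2 * P) (i := i) (j := j) with hT_def
  set y := (TwoDim.predLayerSite d L P : TiltedSite d i j (2 * P) (2 * P) L) with hy_def
  set R := restSet d i j L P with hR_def
  have hy : (axisCoord d L (2 * P) y).val = P - 1 := TwoDim.val_axisCoord_predLayerSite hP
  have hyT : (axisCoord d L (2 * P) (y + T)).val = P - 1 := by
    rw [map_add, hT_def, axisCoord_tiltedTwist d L _ hij, add_zero, hy]
  have hNpos : (0 : ℝ) < N := by exact_mod_cast hN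
  -- the constants
  set A : ℝ := c₁ ^ 9 * N with hA
  set B : ℝ := 2 ^ R.card * N ^ 2 * 2 ^ 9 * N ^ 9 with hB
  set C : ℝ := 2 * (N ^ 2 * (2 ^ 8 * N ^ 9)) + 4 * B with hC
  have hApos : 0 < A := by positivity
  have hCpos : 0 < C := by positivity
  refine ⟨min (1 / (2 * N)) (A / C), lt_min (by positivity) (div_pos hApos hCpos), fun β hβ hβ0 => ?_⟩
  have hγ : 2 * β * N ≤ 1 := by
    have h := (le_min_iff.1 hβ0).1; rw [le_div_iff₀ (by positivity)] at h; linarith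
  have hβN : β * N ≤ 1 := by nlinarith
  have hβC : β * C ≤ A := by have h := (le_min_iff.1 hβ0).2; rwa [le_div_iff₀ hCpos] at h
  -- geometry of the four plaquettes
  have hUpT : y + e i + e i + T = (y + T) + e i + e i := by abel
  have hUp : y + e i + e i = (y + T) + e i + e i + T := by
    rw [show (y + T) + e i + e i + T = y + e i + e i + (T + T) by abel, hT_def,
      tiltedTwist_add_tiltedTwist d L _ hij, add_zero]
  -- the four families, split at order 8
  have hsplit := fun u v => PairExp.abs_sum_pairT_sub_sum_filter_le ρ e β hρ hβ.le hγ R u v 8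
  have htail : (2 : ℝ) ^ R.card * (N ^ 2 * (2 * β * N) ^ (8 + 1)) = β ^ 9 * B := by rw [hB]; ring
  -- far families vanish through order 8
  have hfar1 : ∑ Q ∈ R.powerset.filter (fun Q => Q.card ≤ 8), PairExp.pairT ρ e β Q (vUpT d i j L P q) (vLo d i j L P q) = 0 :=
    sum_filter_eq_zero_of fun Q hQ hc => pairT_far_eq_zero ρ q hP hij hL hq1 hq2 hρ hz₀ hω β hy hQ hc
  have hfar2 : ∑ Q ∈ R.powerset.filter (fun Q => Q.card ≤ 8), PairExp.pairT ρ e β Q (vUp d i j L P q) (vLoT d i j L P q) = 0 := by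
    refine sum_filter_eq_zero_of fun Q hQ hc => ?_
    unfold vUp vLoT
    rw [← hy_def, ← he_def, ← hT_def, hUp]
    exact pairT_far_eq_zero ρ q hP hij hL hq1 hq2 hρ hz₀ hω β hyT hQ hc
  -- near families reduce to the tube terms
  have hw : (axisCoord d L (2 * P) (y + e i + e i)).val = P + 1 := by
    rw [val_axisCoord_add_self hP _ (by rw [val_axisCoord_up hP hy]; omega), val_axisCoord_up hP hy]
  have hwT : (axisCoord d L (2 * P) (y + T + e i + e i)).val = P + 1 := by
    rw [val_axisCoord_add_self hP _ (by rw [val_axisCoord_up hP hyT]; omega), val_axisCoord_up hP hyT]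
  have hnear1 : ∑ Q ∈ R.powerset.filter (fun Q => Q.card ≤ 8), PairExp.pairT ρ e β Q (vUp d i j L P q) (vLo d i j L P q) =
      PairExp.pairT ρ e β (tube q (y + e i + e i, q) (y, q)) (y + e i + e i, q) (y, q) := by
    refine sum_filter_eq_single_of (tube_subset_restSet q hP hq1 hq2 hy hw)
      (by rw [card_tube q hP hij hL hq1 hq2 hy hw]) fun Q hQ hc hne => ?_
    by_contra h
    exact hne (eq_tube_of_pairT_ne_zero ρ q hP hij hL hq1 hq2 hρ hz₀ hω hy hw hQ hc h)
  have hnear2 : ∑ Q ∈ R.powerset.filter (fun Q => Q.card ≤ 8), PairExp.pairT ρ e β Q (vUpT d i j L P q) (vLoT d i j L P q) =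
      PairExp.pairT ρ e β (tube q (y + T + e i + e i, q) (y + T, q)) (y + T + e i + e i, q) (y + T, q) := by
    have hv : vUpT d i j L P q = (y + T + e i + e i, q) := by unfold vUpT; rw [← hy_def, ← he_def, ← hT_def, hUpT]
    rw [hv]
    refine sum_filter_eq_single_of (tube_subset_restSet q hP hq1 hq2 hyT hwT)
      (by rw [card_tube q hP hij hL hq1 hq2 hyT hwT]) fun Q hQ hc hne => ?_
    by_contra h
    exact hne (eq_tube_of_pairT_ne_zero ρ q hP hij hL hq1 hq2 hρ hz₀ hω hyT hwT hQ hc h)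
  have htube1 := pairT_tube_ge ρ q hR1 hP hij hL hq1 hq2 hρ hβ.le hβN hy
  have htube2 := pairT_tube_ge ρ q hR1 hP hij hL hq1 hq2 hρ hβ.le hβN hyT
  -- the four tails
  have t1 := hsplit (vUpT d i j L P q) (vLo d i j L P q)
  have t2 := hsplit (vUpT d i j L P q) (vLoT d i j L P q)
  have t3 := hsplit (vUp d i j L P q) (vLo d i j L P q)
  have t4 := hsplit (vUp d i j L P q) (vLoT d i j L P q)
  rw [htail, abs_le] at t1 t2 t3 t4
  rw [hfar1] at t1
  rw [hnear2] at t2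
  rw [hnear1] at t3
  rw [hfar2] at t4
  -- assemble
  have htrick : trickSum d i j L P ρ q β =
      ∑ Q ∈ R.powerset, PairExp.pairT ρ e β Q (vUpT d i j L P q) (vLo d i j L P q) -
        ∑ Q ∈ R.powerset, PairExp.pairT ρ e β Q (vUpT d i j L P q) (vLoT d i j L P q) -
        ∑ Q ∈ R.powerset, PairExp.pairT ρ e β Q (vUp d i j L P q) (vLo d i j L P q) +
        ∑ Q ∈ R.powerset, PairExp.pairT ρ e β Q (vUp d i j L P q) (vLoT d i j L P q) := by
    unfold trickSum
    rw [← hR_def, ← he_def, ← sum_sub_distrib, ← sum_sub_distrib, ← sum_add_distrib]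
  have h8 : 0 < β ^ 8 := pow_pos hβ 8
  have hfinal : trickSum d i j L P ρ q β ≤ -(2 * β ^ 8 * A) + β ^ 9 * C := by
    rw [htrick, hC]
    nlinarith [t1.2, t2.1, t3.1, t4.2, htube1, htube2]
  have : -(2 * β ^ 8 * A) + β ^ 9 * C = β ^ 8 * (β * C - 2 * A) := by ring
  rw [this] at hfinal
  nlinarith [mul_pos h8 hApos]

/-! ## Reduced-half site reflection positivity fails -/

/-- ★★★ **REDUCED-half site RP along `i` FAILS on the even square tilted box `ℤ^d/Γ(2P, 2P, L)` in
`d ≥ 3` at small coupling, from the character moments**: `P ≥ 2`, `L ≥ 2`, a direction pair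
`q = (q₁, q₂)` with `q₁, q₂ ≠ i` (it exists iff `d ≥ 3`), compact metrisable `G`, continuous `ρ` with a
centre element `ρ z₀ = ω • 1`, `ω ≠ 1`, and (R1) with `c₁ > 0`, `N ≥ 1`. Then `∃ β₀ > 0` such that for
every `0 < β ≤ β₀` the statement "`0 ≤ ∫ conj F(Θ_i U) F(U) dμ_β` for every bounded measurable `F`
reading only the links of `{0 ≤ x_i ≤ P - 1}`" — the shape of `TwoDim.tiltedBox_axisRP_even_twoDim`,
TRUE in `d = 2` at every `β` — is FALSE. [folklore] -/
theorem not_tiltedBox_axisRP_even_red_of_moments (hP : 2 ≤ P) (hij : i ≠ j) (hL : 2 ≤ L)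
    (hq1 : q.1.1 ≠ i) (hq2 : q.1.2 ≠ i) (hρ : Continuous ρ) (hN : 1 ≤ N) {z₀ : G} {ω : ℂ}
    (hz₀ : ρ z₀ = ω • (1 : Matrix (Fin N) (Fin N) ℂ)) (hω : ω ≠ 1) {c₁ : ℝ} (hc₁ : 0 < c₁)
    (hR1 : ∀ x y : G, ∫ g, reTr ρ (x * g⁻¹) * reTr ρ (g * y) ∂haarProbability G = c₁ * reTr ρ (x * y)) :
    ∃ β₀ : ℝ, 0 < β₀ ∧ ∀ β : ℝ, 0 < β → β ≤ β₀ →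
      ¬ ∀ F : Config (TiltedSite d i j (2 * P) (2 * P) L) d G → ℂ, Measurable F →
          (∃ C : ℝ, ∀ U, ‖F U‖ ≤ C) →
          (∀ U V : Config (TiltedSite d i j (2 * P) (2 * P) L) d G,
            (∀ l, TwoDim.IsRedSiteLink (P := P) l → U l = V l) → F U = F V) →
          0 ≤ ∫ U, conj (F (configReflect (tiltedUnit d i j (2 * P) (2 * P) L) i
            (tiltedAxisFlip d L (2 * P) hij) U)) * F U ∂(gibbs ρ (tiltedUnit d i j (2 * P) (2 * P) L) β) := by
  obtain ⟨β₀, hβ₀, hneg⟩ := trickSum_neg_of_small ρ q hP hij hL hq1 hq2 hρ hN hz₀ hω hc₁ hR1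
  exact ⟨β₀, hβ₀, fun β hβ hβ1 => not_redSiteRP_of_trickSum_neg ρ q hP hij hq1 hq2 hρ (hneg β hβ hβ1)⟩

/-- ★★ **`G ≅ SU(N)`, `N ≥ 2`**: reduced-half site RP along `i` fails on the even square tilted box in
`d ≥ 3` at small coupling. [folklore] -/
theorem not_tiltedBox_axisRP_even_red_specialUnitary (hP : 2 ≤ P) (hij : i ≠ j) (hL : 2 ≤ L)
    (hq1 : q.1.1 ≠ i) (hq2 : q.1.2 ≠ i) (hρ : IsSpecialUnitaryModel ρ) (hN : 2 ≤ N) :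
    ∃ β₀ : ℝ, 0 < β₀ ∧ ∀ β : ℝ, 0 < β → β ≤ β₀ →
      ¬ ∀ F : Config (TiltedSite d i j (2 * P) (2 * P) L) d G → ℂ, Measurable F →
          (∃ C : ℝ, ∀ U, ‖F U‖ ≤ C) →
          (∀ U V : Config (TiltedSite d i j (2 * P) (2 * P) L) d G,
            (∀ l, TwoDim.IsRedSiteLink (P := P) l → U l = V l) → F U = F V) →
          0 ≤ ∫ U, conj (F (configReflect (tiltedUnit d i j (2 * P) (2 * P) L) i
            (tiltedAxisFlip d L (2 * P) hij) U)) * F U ∂(gibbs ρ (tiltedUnit d i j (2 * P) (2 * P) L) β) := by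
  obtain ⟨z₀, ω, hω, hz₀⟩ := DiagRPSUN.exists_smul_one ρ hρ hN
  obtain ⟨c₁, hc₁, hR1⟩ := DiagRPSUN.exists_re_conv_const ρ hρ hN
  exact not_tiltedBox_axisRP_even_red_of_moments ρ q hP hij hL hq1 hq2 hρ.1 (by omega) hz₀ hω hc₁ hR1

/-- ★★ **`G ≅ U(N)`, `N ≥ 1`**: reduced-half site RP along `i` fails on the even square tilted box in
`d ≥ 3` at small coupling. [folklore] -/
theorem not_tiltedBox_axisRP_even_red_unitary (hP : 2 ≤ P) (hij : i ≠ j) (hL : 2 ≤ L)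
    (hq1 : q.1.1 ≠ i) (hq2 : q.1.2 ≠ i) (hρ : IsUnitaryModel ρ) (hN : 1 ≤ N) :
    ∃ β₀ : ℝ, 0 < β₀ ∧ ∀ β : ℝ, 0 < β → β ≤ β₀ →
      ¬ ∀ F : Config (TiltedSite d i j (2 * P) (2 * P) L) d G → ℂ, Measurable F →
          (∃ C : ℝ, ∀ U, ‖F U‖ ≤ C) →
          (∀ U V : Config (TiltedSite d i j (2 * P) (2 * P) L) d G,
            (∀ l, TwoDim.IsRedSiteLink (P := P) l → U l = V l) → F U = F V) →
          0 ≤ ∫ U, conj (F (configReflect (tiltedUnit d i j (2 * P) (2 * P) L) i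
            (tiltedAxisFlip d L (2 * P) hij) U)) * F U ∂(gibbs ρ (tiltedUnit d i j (2 * P) (2 * P) L) β) := by
  obtain ⟨z₀, ω, hω, hz₀⟩ := DiagRPSUN.exists_smul_one_unitary ρ hρ
  have hNpos : (0 : ℝ) < N := by exact_mod_cast hN
  exact not_tiltedBox_axisRP_even_red_of_moments ρ q hP hij hL hq1 hq2 hρ.1 hN hz₀ hω
    (c₁ := (2 * N : ℝ)⁻¹) (by positivity) (DiagRPSUN.integral_re_trace_mul_inv_mul_unitary ρ hρ)

/-! ## Concrete: `SU(N)` and `U(N)` on `ℤ³/Γ(2P, 2P, L)` -/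

section Concrete

open Literature.MathematicalPhysics.QuantumLattice

/-- The transverse direction pair `(1, 2)` of `ℤ³` (in-plane axis `i = 0`). [folklore] -/
def q12 : DirPair 3 := ⟨(1, 2), by decide⟩

/-- ★★★ **`SU(N)` lattice Yang–Mills (`N ≥ 2`) on the three-dimensional even square tilted box
`ℤ³/Γ(2P, 2P, L)` (`P ≥ 2`, `L ≥ 2`, tilted plane `(0, 1)`): reduced-half site RP along the axis `0`
FAILS for all sufficiently small `β > 0`** — although it holds at every `β` in two dimensions
(`TwoDim.tiltedBox_axisRP_even_fin_two`). [folklore] -/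
theorem not_tiltedBox_axisRP_even_red_suN (hP : 2 ≤ P) (hL : 2 ≤ L) (hN : 2 ≤ N) :
    ∃ β₀ : ℝ, 0 < β₀ ∧ ∀ β : ℝ, 0 < β → β ≤ β₀ →
      ¬ ∀ F : Config (TiltedSite 3 0 1 (2 * P) (2 * P) L) 3 (Matrix.specialUnitaryGroup (Fin N) ℂ) → ℂ, Measurable F →
          (∃ C : ℝ, ∀ U, ‖F U‖ ≤ C) →
          (∀ U V : Config (TiltedSite 3 0 1 (2 * P) (2 * P) L) 3 (Matrix.specialUnitaryGroup (Fin N) ℂ),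
            (∀ l, TwoDim.IsRedSiteLink (P := P) l → U l = V l) → F U = F V) →
          0 ≤ ∫ U, conj (F (configReflect (tiltedUnit 3 0 1 (2 * P) (2 * P) L) 0
            (tiltedAxisFlip 3 L (2 * P) Fin.zero_ne_one) U)) * F U
            ∂(gibbs (fundamentalRep (Fin N)) (tiltedUnit 3 0 1 (2 * P) (2 * P) L) β) := by
  haveI : SecondCountableTopology (Matrix (Fin N) (Fin N) ℂ) :=
    inferInstanceAs (SecondCountableTopology (Fin N → Fin N → ℂ))
  haveI : SecondCountableTopology (Matrix.specialUnitaryGroup (Fin N) ℂ) :=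
    Topology.IsEmbedding.subtypeVal.secondCountableTopology
  exact not_tiltedBox_axisRP_even_red_specialUnitary (fundamentalRep (Fin N)) q12 hP Fin.zero_ne_one hL
    (by decide) (by decide) (Literature.MathematicalPhysics.QuantumFieldTheory.TorusAreaLaw.isSpecialUnitaryModel_fundamentalRep N) hN

/-- ★★★ **`U(N)` lattice gauge theory (`N ≥ 1`) on `ℤ³/Γ(2P, 2P, L)` (`P ≥ 2`, `L ≥ 2`): reduced-half
site RP along the axis `0` FAILS for all sufficiently small `β > 0`.** [folklore] -/
theorem not_tiltedBox_axisRP_even_red_uN (hP : 2 ≤ P) (hL : 2 ≤ L) (hN : 1 ≤ N) :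
    ∃ β₀ : ℝ, 0 < β₀ ∧ ∀ β : ℝ, 0 < β → β ≤ β₀ →
      ¬ ∀ F : Config (TiltedSite 3 0 1 (2 * P) (2 * P) L) 3 (Matrix.unitaryGroup (Fin N) ℂ) → ℂ, Measurable F →
          (∃ C : ℝ, ∀ U, ‖F U‖ ≤ C) →
          (∀ U V : Config (TiltedSite 3 0 1 (2 * P) (2 * P) L) 3 (Matrix.unitaryGroup (Fin N) ℂ),
            (∀ l, TwoDim.IsRedSiteLink (P := P) l → U l = V l) → F U = F V) →
          0 ≤ ∫ U, conj (F (configReflect (tiltedUnit 3 0 1 (2 * P) (2 * P) L) 0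
            (tiltedAxisFlip 3 L (2 * P) Fin.zero_ne_one) U)) * F U
            ∂(gibbs (unitaryFundamentalRep (Fin N) ℂ) (tiltedUnit 3 0 1 (2 * P) (2 * P) L) β) := by
  haveI : SecondCountableTopology (Matrix (Fin N) (Fin N) ℂ) :=
    inferInstanceAs (SecondCountableTopology (Fin N → Fin N → ℂ))
  haveI : SecondCountableTopology (Matrix.unitaryGroup (Fin N) ℂ) :=
    Topology.IsEmbedding.subtypeVal.secondCountableTopology
  exact not_tiltedBox_axisRP_even_red_unitary (unitaryFundamentalRep (Fin N) ℂ) q12 hP Fin.zero_ne_one hL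
    (by decide) (by decide) (Literature.MathematicalPhysics.QuantumFieldTheory.isUnitaryModel_unitaryFundamentalRep N) hN

end Concrete

end RedSite

end TiltedRP

end Summit.QuantumFields.GaugeBoot

end

open MeasureTheory
open scoped ComplexOrder

namespace Summit.QuantumFields.GaugeBoot

namespace TiltedRP

namespace RedSite

/-! ## With a transverse axis `k ∉ {i, j}` (appended) -/

section Axis

variable {d : ℕ} {i j k : Fin d} {L P N : ℕ} [NeZero L] [NeZero P]
variable {G : Type*} [Group G] [TopologicalSpace G] [IsTopologicalGroup G] [CompactSpace G]
  [MeasurableSpace G] [BorelSpace G] [SecondCountableTopology G]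
variable (ρ : G →* Matrix (Fin N) (Fin N) ℂ)

omit [NeZero L] [NeZero P] in
/-- The two directions of the pair `{j, k}` differ from `i` (`j ≠ i`, `k ≠ i`). [folklore] -/
theorem mkDirPair_ne_axis (hij : i ≠ j) (hki : k ≠ i) (hkj : k ≠ j) :
    (mkDirPair j k hkj).1.1 ≠ i ∧ (mkDirPair j k hkj).1.2 ≠ i := by
  unfold mkDirPair
  by_cases h : j < k
  · rw [dif_pos h]; exact ⟨hij.symm, hki⟩
  · rw [dif_neg h]; exact ⟨hki, hij.symm⟩

/-- ★★★ **`G ≅ SU(N)`, `N ≥ 2`, with a transverse axis `k ∉ {i, j}` (`d ≥ 3`)**: reduced-half site RP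
along `i` fails on the even square tilted box `ℤ^d/Γ(2P, 2P, L)` (`P ≥ 2`, `L ≥ 2`) for all small
`β > 0` (witness plaquettes in the plane `{j, k}`). [folklore] -/
theorem not_tiltedBox_axisRP_even_red_specialUnitary_of_axis (hP : 2 ≤ P) (hij : i ≠ j) (hki : k ≠ i)
    (hkj : k ≠ j) (hL : 2 ≤ L) (hρ : Literature.MathematicalPhysics.QuantumFieldTheory.IsSpecialUnitaryModel ρ)
    (hN : 2 ≤ N) :
    ∃ β₀ : ℝ, 0 < β₀ ∧ ∀ β : ℝ, 0 < β → β ≤ β₀ →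
      ¬ ∀ F : Config (TiltedSite d i j (2 * P) (2 * P) L) d G → ℂ, Measurable F →
          (∃ C : ℝ, ∀ U, ‖F U‖ ≤ C) →
          (∀ U V : Config (TiltedSite d i j (2 * P) (2 * P) L) d G,
            (∀ l, TwoDim.IsRedSiteLink (P := P) l → U l = V l) → F U = F V) →
          0 ≤ ∫ U, (starRingEnd ℂ) (F (configReflect (tiltedUnit d i j (2 * P) (2 * P) L) i
            (tiltedAxisFlip d L (2 * P) hij) U)) * F U ∂(gibbs ρ (tiltedUnit d i j (2 * P) (2 * P) L) β) :=
  not_tiltedBox_axisRP_even_red_specialUnitary ρ (mkDirPair j k hkj) hP hij hL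
    (mkDirPair_ne_axis hij hki hkj).1 (mkDirPair_ne_axis hij hki hkj).2 hρ hN

/-- ★★★ **`G ≅ U(N)`, `N ≥ 1`, with a transverse axis `k ∉ {i, j}`**: reduced-half site RP along `i`
fails on the even square tilted box for all small `β > 0`. [folklore] -/
theorem not_tiltedBox_axisRP_even_red_unitary_of_axis (hP : 2 ≤ P) (hij : i ≠ j) (hki : k ≠ i)
    (hkj : k ≠ j) (hL : 2 ≤ L) (hρ : Literature.MathematicalPhysics.QuantumFieldTheory.IsUnitaryModel ρ)
    (hN : 1 ≤ N) :
    ∃ β₀ : ℝ, 0 < β₀ ∧ ∀ β : ℝ, 0 < β → β ≤ β₀ →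
      ¬ ∀ F : Config (TiltedSite d i j (2 * P) (2 * P) L) d G → ℂ, Measurable F →
          (∃ C : ℝ, ∀ U, ‖F U‖ ≤ C) →
          (∀ U V : Config (TiltedSite d i j (2 * P) (2 * P) L) d G,
            (∀ l, TwoDim.IsRedSiteLink (P := P) l → U l = V l) → F U = F V) →
          0 ≤ ∫ U, (starRingEnd ℂ) (F (configReflect (tiltedUnit d i j (2 * P) (2 * P) L) i
            (tiltedAxisFlip d L (2 * P) hij) U)) * F U ∂(gibbs ρ (tiltedUnit d i j (2 * P) (2 * P) L) β) :=
  not_tiltedBox_axisRP_even_red_unitary ρ (mkDirPair j k hkj) hP hij hL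
    (mkDirPair_ne_axis hij hki hkj).1 (mkDirPair_ne_axis hij hki hkj).2 hρ hN

end Axis

end RedSite

end TiltedRP

end Summit.QuantumFields.GaugeBoot
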